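import Mathlib
import Literature.Barriers.MatrixMultiplication.NormalizerBarrier
import Summits.MatrixMultiplication.MatrixMultiplication.Theorems.SubgroupIdentityDesigns.Negative.LevelKCornerSlice
import Summits.MatrixMultiplication.MatrixMultiplication.Theorems.SubgroupIdentityDesigns.Negative.LevelKSandwichRigidity
import Summits.MatrixMultiplication.MatrixMultiplication.Theorems.SubgroupIdentityDesigns.Negative.LevelKVolumeShape
import Summits.MatrixMultiplication.MatrixMultiplication.Theorems.SubgroupIdentityDesigns.Negative.NoRadicalMiddle

/-!
# Stub `stub_levelKSandwichStructure` — line `ghost-calculus-chebotarev` of the crux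
`SubgroupIdentityDesigns` (stmt-MatrixMultiplication-14079)

Crux
`Summit.MatrixMultiplication.MatrixMultiplication.Theses.LevelGradedCohnUmans.SubgroupIdentityDesigns`;
this file proves the registered NEGATIVE helper `stub_levelKSandwichStructure` verbatim (name +
signature): the FORCED ARCHITECTURE THEOREM for level-`k` sandwich witnesses of
`stub_sandwichDesigns` in the cell `3k ≤ m`.  It is a pure composition of the four wave-1
structure theorems `stub_levelKCornerSlice`, `stub_levelKSandwichRigidity`,
`stub_levelKVolumeShape` and `stub_levelKNoRadicalMiddle` of this directory; no new mathematics.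

Setting.  `G = GL_m(𝔽_p)`, `1 ≤ k`, `3k ≤ m`; indices `Fin m` split into the top block `{i < k}`
and the bottom block `{k ≤ i}`; three subgroups `H₁, H₂, H₃ ≤ G` with the subgroup triple product
property (`Literature.Barriers.MatrixMultiplication.SubgroupTPP`); the block root groups
`U⁻ = {u : (u - 1) i j ≠ 0 → k ≤ i ∧ j < k}` (unipotent radical of the opposite maximal parabolic
`P⁻`, supported in the bottom-left block) and `U⁺ = {v : (v - 1) i j ≠ 0 → i < k ∧ k ≤ j}`
(unipotent radical of the maximal parabolic `P`, top-right block).  Hypotheses (a level-`k`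
SANDWICH DESIGN): `U⁻ ≤ H₁`, `U⁺ ≤ H₃`, and the level-`k` identity test of the crux (a Fourier
table `c` on `M_m(𝔽_p)` supported in rank `≤ k` with `f_c(1) = 1` and `f_c(a b g) = 0` whenever
`a b g ≠ 1`, `a ∈ H₁, b ∈ H₂, g ∈ H₃`).

Conclusions (the forced architecture):

* (C1) `H₁ ≤ P⁻`: every `h ∈ H₁` has zero top-right block;
* (C2) the corner kernel of `H₁` (elements with identity top-left block) is exactly `U⁻`-shaped,
  i.e. the radical `U⁻` is the exact corner kernel;
* (C3) `H₃ ≤ P`: every `h ∈ H₃` has zero bottom-left block;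
* (C4) the corner kernel of `H₃` is exactly `U⁺`-shaped;
* (C5) corner faithfulness of the middle: `b ≠ 1 ⇒` the top-left block of `a b g - 1` is nonzero;
* (C6) the Levi decorations are corner-faithful, whence the volume shape
  `|H₁| |H₃| ≤ p^{k(m-k)} p^{k(m-k)} |GL_k(𝔽_p)|`;
* (C7) the middle group is corner-avoiding and therefore contains no unipotent radical
  `U_W = {b : b|_W = id, (b - 1) V ≤ W}` of the stabiliser of a proper nonzero subspace
  `W ≤ 𝔽_p^m`.

Proof (composition).  From `1 ≤ k` and `3k ≤ m` we get `2k < m` and `k ≤ m`.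
`stub_levelKCornerSlice` (`3k ≤ m`, sandwich, identity test) gives the SLICE property: every
product `a b g` with identity top-left block factors as `u v`, `u ∈ U⁻`, `v ∈ U⁺`.
`stub_levelKSandwichRigidity` (`2k < m`, TPP, sandwich, slice) gives (C1)–(C5).
`stub_levelKVolumeShape` (`k ≤ m`, TPP, sandwich, (C1), (C3), and the slice specialised to
`b = 1`) gives (C6).  `stub_levelKNoRadicalMiddle` (`2k < m`, corner avoidance on `H₂` = (C5)
specialised to `a = g = 1`) gives (C7).  Sorry-free; standard axioms; no new definitions.
-/

set_option linter.dupNamespace false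

noncomputable section

open scoped BigOperators
open Literature.Barriers.MatrixMultiplication

namespace Summit.MatrixMultiplication.MatrixMultiplication.Theorems.SubgroupIdentityDesigns.Negative

/-- **Forced architecture of a level-`k` sandwich design, `3k ≤ m`** (negative helper for the
line `ghost-calculus-chebotarev` of the crux `SubgroupIdentityDesigns`).  In `GL_m(𝔽_p)` with
`1 ≤ k`, `3k ≤ m`, let `H₁, H₂, H₃` satisfy the subgroup TPP, let `H₁` contain every `U⁻`-shaped
unit and `H₃` every `U⁺`-shaped unit, and let the triple pass the level-`k` identity test of the
crux.  Then: (C1) `H₁ ≤ P⁻` (zero top-right block); (C2) the corner kernel of `H₁` is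
`U⁻`-shaped; (C3) `H₃ ≤ P` (zero bottom-left block); (C4) the corner kernel of `H₃` is
`U⁺`-shaped; (C5) `b ≠ 1 ⇒` the top-left block of `a b g - 1` is nonzero; (C6)
`|H₁| |H₃| ≤ p^{k(m-k)} p^{k(m-k)} |GL_k(𝔽_p)|`; (C7) `H₂` contains no unipotent radical `U_W`
of the stabiliser of a proper nonzero subspace `W`.  Composition of `stub_levelKCornerSlice`,
`stub_levelKSandwichRigidity`, `stub_levelKVolumeShape`, `stub_levelKNoRadicalMiddle`. -/
theorem stub_levelKSandwichStructure :
    ∀ (p : ℕ) [Fact p.Prime] (m k : ℕ), 1 ≤ k → 3 * k ≤ m →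
      ∀ (H₁ H₂ H₃ : Subgroup (Matrix.GeneralLinearGroup (Fin m) (ZMod p))),
      Literature.Barriers.MatrixMultiplication.SubgroupTPP H₁ H₂ H₃ →
      (∀ u : Matrix.GeneralLinearGroup (Fin m) (ZMod p),
        (∀ i j : Fin m, ((u : Matrix (Fin m) (Fin m) (ZMod p)) - 1) i j ≠ 0 → k ≤ i.val ∧ j.val < k) →
          u ∈ H₁) →
      (∀ v : Matrix.GeneralLinearGroup (Fin m) (ZMod p),
        (∀ i j : Fin m, ((v : Matrix (Fin m) (Fin m) (ZMod p)) - 1) i j ≠ 0 → i.val < k ∧ k ≤ j.val) →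
          v ∈ H₃) →
      (∃ c : Matrix (Fin m) (Fin m) (ZMod p) → ℂ, (∀ M, k < M.rank → c M = 0) ∧
        (∑ M : Matrix (Fin m) (Fin m) (ZMod p), c M * ZMod.stdAddChar (Matrix.trace
          (M * ((1 : Matrix.GeneralLinearGroup (Fin m) (ZMod p)) : Matrix (Fin m) (Fin m) (ZMod p))))) = 1 ∧
        ∀ a ∈ H₁, ∀ b ∈ H₂, ∀ g ∈ H₃, a * b * g ≠ 1 →
          (∑ M : Matrix (Fin m) (Fin m) (ZMod p), c M * ZMod.stdAddChar (Matrix.trace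
            (M * ((a * b * g : Matrix.GeneralLinearGroup (Fin m) (ZMod p)) :
              Matrix (Fin m) (Fin m) (ZMod p))))) = 0) →
      (∀ h ∈ H₁, ∀ i j : Fin m, i.val < k → k ≤ j.val → (h : Matrix (Fin m) (Fin m) (ZMod p)) i j = 0) ∧
      (∀ h ∈ H₁, (∀ i j : Fin m, i.val < k → j.val < k →
          ((h : Matrix (Fin m) (Fin m) (ZMod p)) - 1) i j = 0) →
        ∀ i j : Fin m, ((h : Matrix (Fin m) (Fin m) (ZMod p)) - 1) i j ≠ 0 → k ≤ i.val ∧ j.val < k) ∧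
      (∀ h ∈ H₃, ∀ i j : Fin m, k ≤ i.val → j.val < k → (h : Matrix (Fin m) (Fin m) (ZMod p)) i j = 0) ∧
      (∀ h ∈ H₃, (∀ i j : Fin m, i.val < k → j.val < k →
          ((h : Matrix (Fin m) (Fin m) (ZMod p)) - 1) i j = 0) →
        ∀ i j : Fin m, ((h : Matrix (Fin m) (Fin m) (ZMod p)) - 1) i j ≠ 0 → i.val < k ∧ k ≤ j.val) ∧
      (∀ a ∈ H₁, ∀ b ∈ H₂, ∀ g ∈ H₃, b ≠ 1 →
        ∃ i j : Fin m, i.val < k ∧ j.val < k ∧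
          (((a * b * g : Matrix.GeneralLinearGroup (Fin m) (ZMod p)) : Matrix (Fin m) (Fin m) (ZMod p)) - 1)
            i j ≠ 0) ∧
      Nat.card H₁ * Nat.card H₃ ≤
        p ^ (k * (m - k)) * p ^ (k * (m - k)) * Nat.card (Matrix.GeneralLinearGroup (Fin k) (ZMod p)) ∧
      (∀ W : Submodule (ZMod p) (Fin m → ZMod p), W ≠ ⊥ → W ≠ ⊤ →
        ¬ (∀ b : Matrix.GeneralLinearGroup (Fin m) (ZMod p),
          (∀ w ∈ W, (b : Matrix (Fin m) (Fin m) (ZMod p)).mulVec w = w) →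
          (∀ x : Fin m → ZMod p, (b : Matrix (Fin m) (Fin m) (ZMod p)).mulVec x - x ∈ W) → b ∈ H₂)) := by
  intro p _ m k hk hkm H₁ H₂ H₃ htpp hL hR hid
  -- Arithmetic side conditions of the wave-1 theorems.
  have h2k : 2 * k < m := by omega
  have hkm' : k ≤ m := by omega
  -- SLICE: every product `a b g` with identity top-left block is `u v`, `u ∈ U⁻`, `v ∈ U⁺`.
  have hslice := stub_levelKCornerSlice p m k hkm H₁ H₂ H₃ hL hR hid
  -- (C1)–(C5): rigidity.
  obtain ⟨hC1, hC2, hC3, hC4, hC5⟩ :=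
    stub_levelKSandwichRigidity p m k h2k H₁ H₂ H₃ htpp hL hR hslice
  -- The slice specialised to `b = 1` (outer slice on `H₁ H₃`).
  have hslice13 : ∀ a ∈ H₁, ∀ g ∈ H₃,
      (∀ i j : Fin m, i.val < k → j.val < k →
        (((a * g : Matrix.GeneralLinearGroup (Fin m) (ZMod p)) : Matrix (Fin m) (Fin m) (ZMod p)) - 1)
          i j = 0) →
      ∃ u v : Matrix.GeneralLinearGroup (Fin m) (ZMod p),
        (∀ i j : Fin m, ((u : Matrix (Fin m) (Fin m) (ZMod p)) - 1) i j ≠ 0 → k ≤ i.val ∧ j.val < k) ∧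
        (∀ i j : Fin m, ((v : Matrix (Fin m) (Fin m) (ZMod p)) - 1) i j ≠ 0 → i.val < k ∧ k ≤ j.val) ∧
        a * g = u * v := by
    intro a ha g hg hcorner
    have h := hslice a ha 1 H₂.one_mem g hg (by simpa only [mul_one] using hcorner)
    simpa only [mul_one] using h
  -- (C6): volume shape.
  have hC6 := stub_levelKVolumeShape p m k hkm' H₁ H₂ H₃ htpp hL hR hC1 hC3 hslice13
  -- Corner avoidance of the middle group: (C5) at `a = g = 1`.
  have hcornerH₂ : ∀ b ∈ H₂, b ≠ 1 →
      ∃ i j : Fin m, i.val < k ∧ j.val < k ∧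
        (((b : Matrix.GeneralLinearGroup (Fin m) (ZMod p)) : Matrix (Fin m) (Fin m) (ZMod p)) - 1)
          i j ≠ 0 := by
    intro b hb hb1
    have h := hC5 1 H₁.one_mem b hb 1 H₃.one_mem hb1
    simpa only [one_mul, mul_one] using h
  -- (C7): no radical middle.
  refine ⟨hC1, hC2, hC3, hC4, hC5, hC6, ?_⟩
  intro W hbot htop hrad
  exact stub_levelKNoRadicalMiddle p m k h2k H₂ hcornerH₂ W hbot htop hrad

end Summit.MatrixMultiplication.MatrixMultiplication.Theorems.SubgroupIdentityDesigns.Negative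

end
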